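/-
Origin: expansion seat `planner-pub-hodgecm-pv02-g7-0`, handover ONE: `import Pv02g7.WeilThetaModelLinear` -> `import HodgeCM.Automorphic.WeilThetaModelLinear`; other import HodgeCM.Automorphic.WeilThetaModelHeisenbergPs (tree) unchanged ; after pv02-g7 #1 WeilThetaModelLinear (RUN 29 kit t29-pv02g7.txt row 1; HOLD iff #1 not landed) (`HOME/pub-hodgecm-pv02-g7/lean/Pv02g7/WeilThetaModelHeisenbergLinear.lean`, md5 82d2fa65, 247 lines);
landed by the gen-8 packager in gate run 30 as `HodgeCM/Automorphic/WeilThetaModelHeisenbergLinear.lean` (import ^import Pv02g7\.WeilThetaModelLinear[ \t]*$→import HodgeCM.Automorphic.WeilThetaModelLinear ×1).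
-/
/-
Origin: HOME/pub-hodgecm-pv02-g7/lean/Pv02g7/WeilThetaModelHeisenbergLinear.lean — session planner-pub-hodgecm-pv02-g7-0
(unit pub-hodgecm-pv02-g7, DAG-NODE PROVER #02 gen 7; lineage pv02).
Intended final place (packager's call): `HodgeCM/Automorphic/WeilThetaModelHeisenbergLinear.lean`.
NEW ADDITIVE LEAF.  WIP import ↦ landed name: `Pv02g7.WeilThetaModelLinear` ↦ `HodgeCM.Automorphic.WeilThetaModelLinear`
(this seat's #1; lands AFTER it); the other import is the TREE module `HodgeCM.Automorphic.WeilThetaModelHeisenbergPs`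
(pv14 lineage; it imports the whole Heisenberg family: `…Heisenberg`, `…HeisenbergLattice`, `…HeisenbergFourier`,
`…HeisenbergWeyl`, `…HeisenbergWeylLattice`, `…HeisenbergAdjoin`).
KIND: KERNEL — nothing cited, nothing posited; no statement of PerL / QW8 / the 2001 programme is a hypothesis.
-/
import Summits.HodgeConjecture.HodgeCM.Automorphic.WeilThetaModelHeisenbergPs_2
import Summits.HodgeConjecture.HodgeCM.Automorphic.WeilThetaModelLinear_2

/-!
# Every constructed Heisenberg-type Weil theta model of the package is LINEAR

pv14's lineage built prl1-g4's `WeilThetaModel` record, with every field a theorem, on the archimedean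
Schrödinger–Heisenberg data: `heisenbergModel` (`Heis V`, [We64] n° 41 theta series), `heisenbergWeylModel`
(`Heis V ⋊ ⟨σ⟩`, the Weyl element acting by `𝓕`, self-dual lattice), `heisenbergAdjoinModel` (`Heis V ⋊[φ] D` for any
intertwined finite group `D`), `heisenbergPsModel` (`D = F⟨σ,u⟩`), and their re-typings over cocompact lattice models
(`…OverLattice`, `…Std`).  In all of them `S(X) = 𝓢(V, ℂ)`, the group acts by continuous `ℂ`-linear operators
(`repCLM`, `repW`, `repSD`), and the theta functional is a lattice sum `Θ_Φ(x) = Σ_{v ∈ L} (ρ(x)Φ)(v)`.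

This file records that each of these models carries the linear structure `WeilThetaModel.LinearStr` of this seat's
`WeilThetaModelLinear` — so the consequences there (`Module ℂ ↥M.SK`, `ωₗ`, `θ_add / θ_smul / θₗ`,
`opTC_θ_add / opTC_θ_smul`, …) apply to every archimedean model in the tree, and an end state assembled from them
meets the binder `[(C.wm V c).LinearStr]` of pv11-g9's `EndStateLinear` by `inferInstance`.

* §1 `thetaH_add / thetaH_smul / thetaHₗ` — Weil's `Θ_Φ(h)` is `ℂ`-linear in `Φ` (additivity for a discrete `L`, via
  pv14's `thetaH_eq_thetaCLM`; homogeneity unconditionally, `tsum_mul_left`); the same for `thetaW`, `thetaSD`.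
* §2 instances: `heisenbergModel`, `heisenbergModelOverLattice`, `heisenbergModelStd`; `heisenbergWeylModel`,
  `heisenbergWeylModelOverLattice`, `heisenbergWeylModelStd`, `heisenbergWeylModelStdOverLattice`;
  `heisenbergAdjoinModel`, `heisenbergAdjoinModelOverLattice`; `heisenbergPsModel`, `heisenbergPsModelOverLattice`,
  `heisenbergPsModelStd`.
* §3 sanity: on `heisenbergModelStd n m` (NO hypotheses) `θ_{Φ+Ψ} = θ_Φ + θ_Ψ` holds by the general theorem —
  the class is inhabited hypothesis-free.
-/

set_option autoImplicit false

noncomputable section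

open scoped SchwartzMap

namespace HodgeCM
namespace SchwartzWeil

/-! ## 1. Linearity of Weil's theta functional `Φ ↦ Θ_Φ(x)` on the Heisenberg-type groups -/

section ThetaH

variable (V : Type) [NormedAddCommGroup V] [InnerProductSpace ℝ V] [FiniteDimensional ℝ V] [MeasurableSpace V]
  [BorelSpace V] (L : Submodule ℤ V) (m : ℤ)

/-- `Θ_{aΦ}(h) = a Θ_Φ(h)` (no hypothesis on `L`). -/
theorem thetaH_smul (a : ℂ) (Φ : 𝓢(V, ℂ)) (h : Heis V) : thetaH V L m (a • Φ) h = a * thetaH V L m Φ h := by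
  simp only [thetaH, map_smul, smul_apply, smul_eq_mul, tsum_mul_left]

variable [DiscreteTopology L]

/-- `Θ_{Φ+Ψ}(h) = Θ_Φ(h) + Θ_Ψ(h)` (`L` discrete, so that the lattice sums converge: pv14's `thetaH_eq_thetaCLM`). -/
theorem thetaH_add (Φ Ψ : 𝓢(V, ℂ)) (h : Heis V) :
    thetaH V L m (Φ + Ψ) h = thetaH V L m Φ h + thetaH V L m Ψ h := by
  simp only [thetaH_eq_thetaCLM, map_add]

/-- `Φ ↦ Θ_Φ(h)` as a `ℂ`-linear functional on `𝓢(V, ℂ)`. -/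
def thetaHₗ (h : Heis V) : 𝓢(V, ℂ) →ₗ[ℂ] ℂ where
  toFun Φ := thetaH V L m Φ h
  map_add' Φ Ψ := thetaH_add V L m Φ Ψ h
  map_smul' a Φ := thetaH_smul V L m a Φ h

/-- (Ported verbatim from the HodgeCMPerL package; no docstring in the source.) -/
@[simp] theorem thetaHₗ_apply (h : Heis V) (Φ : 𝓢(V, ℂ)) : thetaHₗ V L m h Φ = thetaH V L m Φ h := rfl

end ThetaH

section ThetaW

variable (V : Type) [NormedAddCommGroup V] [InnerProductSpace ℝ V] [FiniteDimensional ℝ V] [MeasurableSpace V]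
  [BorelSpace V] (L : Submodule ℤ V) (m : ℤ) (hm : m ≠ 0)

/-- (Ported verbatim from the HodgeCMPerL package; no docstring in the source.) -/
theorem thetaW_smul (a : ℂ) (Φ : 𝓢(V, ℂ)) (x : HeisW V m hm) :
    thetaW V L m hm (a • Φ) x = a * thetaW V L m hm Φ x := by
  rw [thetaW_def, thetaW_def, map_smul, thetaH_smul]

variable [DiscreteTopology L]

/-- (Ported verbatim from the HodgeCMPerL package; no docstring in the source.) -/
theorem thetaW_add (Φ Ψ : 𝓢(V, ℂ)) (x : HeisW V m hm) :
    thetaW V L m hm (Φ + Ψ) x = thetaW V L m hm Φ x + thetaW V L m hm Ψ x := by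
  rw [thetaW_def, thetaW_def, thetaW_def, map_add, thetaH_add]

end ThetaW

section ThetaSD

variable (V : Type) [NormedAddCommGroup V] [InnerProductSpace ℝ V] [FiniteDimensional ℝ V] [MeasurableSpace V]
  [BorelSpace V] (L : Submodule ℤ V) (m : ℤ) {D : Type} [Group D] {φ : D →* MulAut (Heis V)}
  {π : D →* (𝓢(V, ℂ) →L[ℂ] 𝓢(V, ℂ))ˣ}

/-- (Ported verbatim from the HodgeCMPerL package; no docstring in the source.) -/
theorem thetaSD_smul (hc : Intertwines V m φ π) (a : ℂ) (Φ : 𝓢(V, ℂ)) (x : Heis V ⋊[φ] D) :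
    thetaSD V L m hc (a • Φ) x = a * thetaSD V L m hc Φ x := by
  rw [thetaSD_def, thetaSD_def, map_smul, thetaH_smul]

variable [DiscreteTopology L]

/-- (Ported verbatim from the HodgeCMPerL package; no docstring in the source.) -/
theorem thetaSD_add (hc : Intertwines V m φ π) (Φ Ψ : 𝓢(V, ℂ)) (x : Heis V ⋊[φ] D) :
    thetaSD V L m hc (Φ + Ψ) x = thetaSD V L m hc Φ x + thetaSD V L m hc Ψ x := by
  rw [thetaSD_def, thetaSD_def, thetaSD_def, map_add, thetaH_add]

end ThetaSD

/-! ## 2. The instances -/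

section Heisenberg

variable (V : Type) [NormedAddCommGroup V] [InnerProductSpace ℝ V] [FiniteDimensional ℝ V] [MeasurableSpace V]
  [BorelSpace V] (L : Submodule ℤ V) (m : ℤ) [DiscreteTopology L]

/-- **The Schrödinger–Heisenberg–lattice model `heisenbergModel V L m Γ hΓ` is a LINEAR Weil theta model.** -/
instance linearStr_heisenbergModel (Γ : Subgroup Circle) (hΓ : ∀ u ∈ Γ, u ^ m = 1) :
    (heisenbergModel V L m Γ hΓ).LinearStr where
  instACG := inferInstanceAs (AddCommGroup 𝓢(V, ℂ))
  instMod := inferInstanceAs (Module ℂ 𝓢(V, ℂ))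
  act_add := fun S Φ Ψ => (repCLM V m S).map_add Φ Ψ
  act_smul := fun S a Φ => (repCLM V m S).map_smul a Φ
  theta_add := fun Φ Ψ S => thetaH_add V L m Φ Ψ S
  theta_smul := fun a Φ S => thetaH_smul V L m a Φ S
  zero_mem := Set.mem_univ _
  add_mem := fun _ _ => Set.mem_univ _
  smul_mem := fun _ _ _ => Set.mem_univ _

variable [IsZLattice ℝ L] [NeZero m]

/-- (Ported verbatim from the HodgeCMPerL package; no docstring in the source.) -/
instance linearStr_heisenbergModelOverLattice (Γ : Subgroup Circle) [Finite Γ] (hΓ : ∀ u ∈ Γ, u ^ m = 1) :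
    (heisenbergModelOverLattice V L m Γ hΓ).LinearStr :=
  inferInstanceAs ((heisenbergModel V L m Γ hΓ).LinearStr)

end Heisenberg

/-- The hypothesis-free standard model `(Heis ℝⁿ, arith ℤⁿ m)` is linear. -/
instance linearStr_heisenbergModelStd (n : ℕ) (m : ℤ) [NeZero m] : (heisenbergModelStd n m).LinearStr :=
  inferInstanceAs ((heisenbergModelOverLattice (EuclideanSpace ℝ (Fin n))
    (Submodule.span ℤ (Set.range (PiLp.basisFun 2 ℝ (Fin n)))) m ⊥ _).LinearStr)

section Weyl

variable (V : Type) [NormedAddCommGroup V] [InnerProductSpace ℝ V] [FiniteDimensional ℝ V] [MeasurableSpace V]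
  [BorelSpace V] (L : Submodule ℤ V) (m : ℤ) (hm : m ≠ 0) [DiscreteTopology L] [IsZLattice ℝ L]

/-- **The extended model `heisenbergWeylModel` (Weyl element acting by `𝓕`) is linear.** -/
instance linearStr_heisenbergWeylModel (hL : PoissonSummation.dualLattice L = L) (Γ : Subgroup Circle)
    (hΓ : ∀ u ∈ Γ, u ^ m = 1) : (heisenbergWeylModel V L m hm hL Γ hΓ).LinearStr where
  instACG := inferInstanceAs (AddCommGroup 𝓢(V, ℂ))
  instMod := inferInstanceAs (Module ℂ 𝓢(V, ℂ))
  act_add := fun S Φ Ψ => (repW V m hm S : 𝓢(V, ℂ) →L[ℂ] 𝓢(V, ℂ)).map_add Φ Ψ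
  act_smul := fun S a Φ => (repW V m hm S : 𝓢(V, ℂ) →L[ℂ] 𝓢(V, ℂ)).map_smul a Φ
  theta_add := fun Φ Ψ S => thetaW_add V L m hm Φ Ψ S
  theta_smul := fun a Φ S => thetaW_smul V L m hm a Φ S
  zero_mem := Set.mem_univ _
  add_mem := fun _ _ => Set.mem_univ _
  smul_mem := fun _ _ _ => Set.mem_univ _

omit hm in
/-- (Ported verbatim from the HodgeCMPerL package; no docstring in the source.) -/
instance linearStr_heisenbergWeylModelOverLattice [NeZero m] (hL : PoissonSummation.dualLattice L = L)
    (Γ : Subgroup Circle) [Finite Γ] (hΓ : ∀ u ∈ Γ, u ^ m = 1) :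
    (heisenbergWeylModelOverLattice V L m hL Γ hΓ).LinearStr :=
  inferInstanceAs ((heisenbergWeylModel V L m (NeZero.ne m) hL Γ hΓ).LinearStr)

end Weyl

/-- (Ported verbatim from the HodgeCMPerL package; no docstring in the source.) -/
instance linearStr_heisenbergWeylModelStd (n : ℕ) (m : ℤ) [NeZero m] : (heisenbergWeylModelStd n m).LinearStr :=
  inferInstanceAs ((heisenbergWeylModel (EuclideanSpace ℝ (Fin n))
    (Submodule.span ℤ (Set.range (PiLp.basisFun 2 ℝ (Fin n)))) m (NeZero.ne m) (SelfDual.dualLattice_zn n) ⊥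
    _).LinearStr)

/-- (Ported verbatim from the HodgeCMPerL package; no docstring in the source.) -/
instance linearStr_heisenbergWeylModelStdOverLattice (n : ℕ) (m : ℤ) [NeZero m] :
    (heisenbergWeylModelStdOverLattice n m).LinearStr :=
  inferInstanceAs ((heisenbergWeylModelOverLattice (EuclideanSpace ℝ (Fin n))
    (Submodule.span ℤ (Set.range (PiLp.basisFun 2 ℝ (Fin n)))) m (SelfDual.dualLattice_zn n) ⊥ _).LinearStr)

section Adjoin

variable (V : Type) [NormedAddCommGroup V] [InnerProductSpace ℝ V] [FiniteDimensional ℝ V] [MeasurableSpace V]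
  [BorelSpace V] (L : Submodule ℤ V) (m : ℤ) {D : Type} [Group D] [TopologicalSpace D] [DiscreteTopology D]
  {φ : D →* MulAut (Heis V)} {π : D →* (𝓢(V, ℂ) →L[ℂ] 𝓢(V, ℂ))ˣ} [DiscreteTopology L]

/-- **The model `heisenbergAdjoinModel` on `Heis V ⋊[φ] D` is linear** (any intertwined, theta-fixing `D`). -/
instance linearStr_heisenbergAdjoinModel [IsTopologicalGroup (Heis V ⋊[φ] D)]
    (hφc : ∀ (d : D) (z : Circle), φ d (Heis.center z) = Heis.center z) (hc : Intertwines V m φ π)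
    (hθ : FixesTheta V L m π) (Γ : Subgroup Circle) (hΓ : ∀ u ∈ Γ, u ^ m = 1) :
    (heisenbergAdjoinModel V L m hφc hc hθ Γ hΓ).LinearStr where
  instACG := inferInstanceAs (AddCommGroup 𝓢(V, ℂ))
  instMod := inferInstanceAs (Module ℂ 𝓢(V, ℂ))
  act_add := fun S Φ Ψ => (repSD V m hc S : 𝓢(V, ℂ) →L[ℂ] 𝓢(V, ℂ)).map_add Φ Ψ
  act_smul := fun S a Φ => (repSD V m hc S : 𝓢(V, ℂ) →L[ℂ] 𝓢(V, ℂ)).map_smul a Φ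
  theta_add := fun Φ Ψ S => thetaSD_add V L m hc Φ Ψ S
  theta_smul := fun a Φ S => thetaSD_smul V L m hc a Φ S
  zero_mem := Set.mem_univ _
  add_mem := fun _ _ => Set.mem_univ _
  smul_mem := fun _ _ _ => Set.mem_univ _

variable [IsZLattice ℝ L] [NeZero m] [Countable D]

/-- (Ported verbatim from the HodgeCMPerL package; no docstring in the source.) -/
instance linearStr_heisenbergAdjoinModelOverLattice (hφ : ∀ d : D, Continuous (φ d : Heis V → Heis V))
    (hφc : ∀ (d : D) (z : Circle), φ d (Heis.center z) = Heis.center z) (hφa : PreservesArith V L m φ)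
    (hc : Intertwines V m φ π) (hθ : FixesTheta V L m π) (Γ : Subgroup Circle) [Finite Γ]
    (hΓ : ∀ u ∈ Γ, u ^ m = 1) :
    (heisenbergAdjoinModelOverLattice V L m hφ hφc hφa hc hθ Γ hΓ).LinearStr :=
  haveI := HeisSD.isTopologicalGroup hφ
  inferInstanceAs ((heisenbergAdjoinModel V L m hφc hc hθ Γ hΓ).LinearStr)

end Adjoin

section Ps

variable (V : Type) [NormedAddCommGroup V] [InnerProductSpace ℝ V] [FiniteDimensional ℝ V] [MeasurableSpace V]
  [BorelSpace V] (L : Submodule ℤ V) [DiscreteTopology L] [IsZLattice ℝ L] (m : ℤ)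

/-- **The model `heisenbergPsModel` on `Heis V ⋊ F⟨σ,u⟩` is linear.** -/
instance linearStr_heisenbergPsModel (hm : m ≠ 0) (hL : PoissonSummation.dualLattice L = L)
    (Γ : Subgroup Circle) (hΓ : ∀ u ∈ Γ, u ^ m = 1) : (heisenbergPsModel V L m hm hL Γ hΓ).LinearStr :=
  inferInstanceAs ((heisenbergAdjoinModel V L m (Heis.psAction_center m hm) (intertwines_psRep V m hm)
    (fixesTheta_psRep V L m hL) Γ hΓ).LinearStr)

variable [NeZero m]

/-- (Ported verbatim from the HodgeCMPerL package; no docstring in the source.) -/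
instance linearStr_heisenbergPsModelOverLattice (hL : PoissonSummation.dualLattice L = L) (Γ : Subgroup Circle)
    [Finite Γ] (hΓ : ∀ u ∈ Γ, u ^ m = 1) : (heisenbergPsModelOverLattice V L m hL Γ hΓ).LinearStr :=
  inferInstanceAs ((heisenbergPsModel V L m (NeZero.ne m) hL Γ hΓ).LinearStr)

end Ps

/-- (Ported verbatim from the HodgeCMPerL package; no docstring in the source.) -/
instance linearStr_heisenbergPsModelStd (n : ℕ) (m : ℤ) [NeZero m] : (heisenbergPsModelStd n m).LinearStr :=
  inferInstanceAs ((heisenbergPsModel (EuclideanSpace ℝ (Fin n))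
    (Submodule.span ℤ (Set.range (PiLp.basisFun 2 ℝ (Fin n)))) m (NeZero.ne m) (SelfDual.dualLattice_zn n) ⊥
    _).LinearStr)

/-! ## 3. Hypothesis-free sanity: the general linear theory applies to the standard model -/

/-- On `(Heis ℝⁿ, arith ℤⁿ m)`: `θ_{Φ+Ψ} = θ_Φ + θ_Ψ` on `[Heis] × [U(1)]` — an instance of `WeilThetaModel.θ_add`. -/
theorem heisenbergModelStd_θ_add (n : ℕ) (m : ℤ) [NeZero m] (Φ Ψ : (heisenbergModelStd n m).SK) :
    (heisenbergModelStd n m).θ (Φ + Ψ) = (heisenbergModelStd n m).θ Φ + (heisenbergModelStd n m).θ Ψ :=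
  (heisenbergModelStd n m).θ_add Φ Ψ

end SchwartzWeil
end HodgeCM

end
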